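import Literature.Analysis.InnerProduct.KroneckerEigenvalues
import Summits.RiemannHypothesis.RiemannHypothesis.Theorems.Splittings.BombieriTruncEigen
import Summits.RiemannHypothesis.RiemannHypothesis.Theorems.Splittings.BombieriFozNoDep
import HarnessLib

/-!
# Splittings — x-wuc (xiv-a1): the Gram structure `𝒦_E(Γ_N) = P·G` of Bombieri's truncations and the off-line Bessel bound (K1)

Cell rh-split, seat rh-split-x-wuc g5 (brief sha16 f79c5f09d8bcb036), card `run/shared/lean/pub/rh-split/cards/SPLIT-x-wuc.md` §11
(referee rh-split-ref g3 2026-08-27T06:23:10Z: REPLAY PASS of the scratch `HOME/rh-split-x-wuc/SplitXWucG5.lean`; lead RULING #35: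
cut (xiv)).  Carved VERBATIM from that scratch (file of record sha16 66b013c38c58c722); sections as numbered there.
* §0 the slot involution `tbar` (mirror `ρ ↦ 1 − ρ̄` on `Γ_N`); §1 `F`, `gram`, `gram_eq_integral`, `gram_eigvec` (`G v = μ P v`);
* §2 (K1) `OffGramBound`, `negEig_re_ge_of_offGramBound`: `−B_off · m_off(v) ≤ μ` for every negative real eigenvalue with unit eigenvector
  `v` and any Bessel constant `B_off` of the OFF-LINE exponentials.  All UNCONDITIONAL (no RH, no FOZ, no named fact).
HONEST LABEL: «SPLITTING SEARCH over kernel-typed RH-EQUIVALENCES; a splitting A ∧ B ⟹ RH is CONDITIONAL bookkeeping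
unless A and B are both proved; nothing here bears on the truth of RH.»
-/

set_option linter.dupNamespace false

noncomputable section

open scoped Classical ComplexConjugate
open Set Filter Topology Complex MeasureTheory

namespace Summit.RiemannHypothesis.RiemannHypothesis.Theorems.Splittings.BombieriTruncGram

open Literature.NumberTheory.LFunctions Literature.NumberTheory.LFunctions.Bombieri2000
open Summit.RiemannHypothesis.RiemannHypothesis.Theses.RuelleBand
open Summit.RiemannHypothesis.RiemannHypothesis.Theorems.Splittings.BombieriTruncEigen
open Summit.RiemannHypothesis.RiemannHypothesis.Theorems.Splittings.BombieriFozNoDep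

variable {E : Set ℝ} {N : ℕ}

/-! ## §0 The reflection `γ ↦ γ̄` on `Γ_N` (re-proved from g4 §8, verbatim) -/

/-- The zero-index conjugation `bar` is an involution. -/
theorem bar_bar (i : ZeroIdx) : i.bar.bar = i := by
  obtain ⟨⟨ρ, hρ⟩, k⟩ := i
  have h1 : (1 : ℂ) - conj (1 - conj ρ) = ρ := by simp
  refine Sigma.ext (Subtype.ext h1) ?_
  refine (Fin.heq_ext_iff (congrArg (fun z : ℂ ↦ (riemannZetaZeroOrder z).toNat) h1)).2 ?_
  simp [ZeroIdx.bar]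

/-- `bar` fixes the on-line indices. -/
theorem bar_eq_self {i : ZeroIdx} (h : ¬ i.OffLine) : i.bar = i := by
  obtain ⟨⟨ρ, hρ⟩, k⟩ := i
  have hre : ρ.re = 1 / 2 := by
    simpa [ZeroIdx.OffLine, ZeroIdx.val] using h
  have h1 : (1 : ℂ) - conj ρ = ρ := by
    apply Complex.ext
    · simp [hre]; norm_num
    · simp
  refine Sigma.ext (Subtype.ext h1) ?_
  refine (Fin.heq_ext_iff (congrArg (fun z : ℂ ↦ (riemannZetaZeroOrder z).toNat) h1)).2 ?_
  simp [ZeroIdx.bar]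

/-- `bar` preserves off-line-ness. -/
theorem offLine_bar (i : ZeroIdx) : i.bar.OffLine ↔ i.OffLine := by
  simp only [ZeroIdx.OffLine, ZeroIdx.val_bar, Complex.sub_re, Complex.one_re, Complex.conj_re]
  constructor <;> intro h h' <;> exact h (by linarith)

/-- `bar` preserves the truncation window `truncIdx N`. -/
theorem bar_mem_truncIdx {N : ℕ} {i : ZeroIdx} (h : i ∈ truncIdx N) : i.bar ∈ truncIdx N := by
  simp only [truncIdx, Set.Finite.mem_toFinset, ZeroIdx.trunc, Set.mem_setOf_eq] at h ⊢
  have : i.bar.val - 1 / 2 = -conj (i.val - 1 / 2) := by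
    rw [ZeroIdx.val_bar, map_sub, map_div₀, map_one, map_ofNat]; ring
  rw [this, norm_neg, Complex.norm_conj]
  exact h

/-- `bar` restricted to `Γ_N` (the permutation `P`). -/
def tbar {N : ℕ} (i : truncIdx N) : truncIdx N := ⟨(i : ZeroIdx).bar, bar_mem_truncIdx i.2⟩

/-- `tbar` is `bar` on the truncation window (coercion formula). -/
@[simp] theorem coe_tbar {N : ℕ} (i : truncIdx N) : ((tbar i : truncIdx N) : ZeroIdx) = (i : ZeroIdx).bar := rfl

/-- `tbar` is an involution. -/
theorem tbar_tbar {N : ℕ} (i : truncIdx N) : tbar (tbar i) = i :=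
  Subtype.ext (by simp [bar_bar])

/-- `tbar` fixes the on-line indices. -/
theorem tbar_eq_self {N : ℕ} {i : truncIdx N} (h : ¬ (i : ZeroIdx).OffLine) : tbar i = i :=
  Subtype.ext (by simp [bar_eq_self h])

/-- The parameter of `tbar j` is the conjugate of the parameter of `j`. -/
theorem gamma_tbar {N : ℕ} (j : truncIdx N) :
    ((tbar j : truncIdx N) : ZeroIdx).gamma = conj ((j : ZeroIdx).gamma) := by
  rw [coe_tbar, ZeroIdx.gamma_bar]

/-- `Im γ = 1/2 − Re ρ ∈ (−1/2, 1/2)`. -/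
theorem gamma_im (i : ZeroIdx) : i.gamma.im = 1 / 2 - i.val.re := by
  simp [ZeroIdx.gamma, Complex.mul_im]

/-! ## §1 The Gram form -/

variable {E : Set ℝ} {N : ℕ}

/-- Bombieri's exponential sum `F_x(u) = Σ_{γ ∈ Γ_N} x_γ e^{−iγu}` ((11.2)–(11.3)). -/
def F (N : ℕ) (x : truncIdx N → ℂ) (u : ℝ) : ℂ :=
  ∑ j : truncIdx N, x j * cexp (-(I * (j : ZeroIdx).gamma * u))

/-- The Gram form `⟨F_x, F_y⟩_{L²(E)}` written as the finite double sum `Σ x̄_γ y_{γ'} K_E(γ̄, γ')`, i.e. the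
sesquilinear form of the matrix `G = P · 𝒦_E(Γ_N)`. -/
def gram (E : Set ℝ) (N : ℕ) (x y : truncIdx N → ℂ) : ℂ :=
  ∑ j : truncIdx N, ∑ l : truncIdx N, conj (x j) * y l * KE E (conj ((j : ZeroIdx).gamma)) ((l : ZeroIdx).gamma)

/-- Hermitian symmetry of the kernel: `conj K_E(b̄, a) = K_E(ā, b)`. -/
theorem conj_KE (E : Set ℝ) (a b : ℂ) : conj (KE E (conj b) a) = KE E (conj a) b := by
  simp only [KE, ← integral_conj, ← Complex.exp_conj, map_mul, Complex.conj_I, Complex.conj_conj, map_sub,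
    Complex.conj_ofReal]
  refine integral_congr_ae (Eventually.of_forall fun u ↦ ?_)
  simp only
  congr 1
  ring

/-- The Gram form is Hermitian. -/
theorem conj_gram (x y : truncIdx N → ℂ) : conj (gram E N y x) = gram E N x y := by
  simp only [gram, map_sum, map_mul, Complex.conj_conj]
  rw [Finset.sum_comm]
  refine Finset.sum_congr rfl fun j _ ↦ Finset.sum_congr rfl fun l _ ↦ ?_
  rw [conj_KE]
  ring

/-- Sesquilinearity (the one instance used below). -/
theorem gram_add_add (x y z w : truncIdx N → ℂ) :
    gram E N (x + y) (z + w) = gram E N x z + gram E N x w + (gram E N y z + gram E N y w) := by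
  simp only [gram, Pi.add_apply, map_add, add_mul, mul_add, Finset.sum_add_distrib]
  ring

/-- Real homogeneity. -/
theorem gram_smul (r : ℝ) (x y : truncIdx N → ℂ) :
    gram E N ((r : ℂ) • x) ((r : ℂ) • y) = (r : ℂ) ^ 2 * gram E N x y := by
  simp only [gram, Pi.smul_apply, smul_eq_mul, map_mul, Complex.conj_ofReal, Finset.mul_sum]
  refine Finset.sum_congr rfl fun j _ ↦ Finset.sum_congr rfl fun l _ ↦ ?_
  ring

/-- On a bounded window the Gram form IS the `L²(E)` pairing of the exponential sums. -/
theorem gram_eq_integral {a : ℝ} (hE : E ⊆ Icc (-a) a) (x y : truncIdx N → ℂ) :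
    gram E N x y = ∫ u in E, conj (F N x u) * F N y u := by
  set g : truncIdx N → ℂ := fun i ↦ (i : ZeroIdx).gamma with hg
  have hint : ∀ j l, Integrable (fun u : ℝ ↦ conj (x j) * y l * cexp (I * (conj (g j) - g l) * u))
      (volume.restrict E) := fun j l ↦
    (Continuous.integrableOn_Icc (by fun_prop)).mono_set hE
  have hterm : ∀ (j l) (u : ℝ),
      conj (x j * cexp (-(I * g j * u))) * (y l * cexp (-(I * g l * u))) =
        conj (x j) * y l * cexp (I * (conj (g j) - g l) * u) := by
    intro j l u
    simp only [map_mul, map_neg, ← Complex.exp_conj, Complex.conj_I, Complex.conj_ofReal]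
    rw [mul_mul_mul_comm, ← Complex.exp_add]
    congr 2
    ring
  have hpt : ∀ u : ℝ, ∑ j, ∑ l, conj (x j) * y l * cexp (I * (conj (g j) - g l) * u) =
      conj (F N x u) * F N y u := by
    intro u
    rw [F, F, map_sum, Finset.sum_mul_sum]
    exact Finset.sum_congr rfl fun j _ ↦ Finset.sum_congr rfl fun l _ ↦ (hterm j l u).symm
  calc gram E N x y
      = ∑ j, ∑ l, ∫ u in E, conj (x j) * y l * cexp (I * (conj (g j) - g l) * u) := by
        refine Finset.sum_congr rfl fun j _ ↦ Finset.sum_congr rfl fun l _ ↦ ?_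
        rw [KE, ← integral_const_mul]
    _ = ∑ j, ∫ u in E, ∑ l, conj (x j) * y l * cexp (I * (conj (g j) - g l) * u) := by
        refine Finset.sum_congr rfl fun j _ ↦ ?_
        rw [integral_finsetSum _ fun l _ ↦ hint j l]
    _ = ∫ u in E, ∑ j, ∑ l, conj (x j) * y l * cexp (I * (conj (g j) - g l) * u) := by
        rw [integral_finsetSum _ fun j _ ↦ integrable_finsetSum _ fun l _ ↦ hint j l]
    _ = ∫ u in E, conj (F N x u) * F N y u :=
        integral_congr_ae (Eventually.of_forall fun u ↦ hpt u)

/-- The diagonal of the Gram form is `‖F_x‖²_{L²(E)}` ((11.3)). -/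
theorem gram_self_eq {a : ℝ} (hE : E ⊆ Icc (-a) a) (x : truncIdx N → ℂ) :
    gram E N x x = ((∫ u in E, ‖F N x u‖ ^ 2 : ℝ) : ℂ) := by
  rw [gram_eq_integral hE, ← integral_complex_ofReal]
  refine integral_congr_ae (Eventually.of_forall fun u ↦ ?_)
  simp only
  rw [RCLike.conj_mul]
  norm_cast

/-- The diagonal Gram value is the `L²(E)`-energy of `F N x`: `Re gram(x,x) = ∫_E ‖F N x‖²`. -/
theorem gram_self_re {a : ℝ} (hE : E ⊆ Icc (-a) a) (x : truncIdx N → ℂ) :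
    (gram E N x x).re = ∫ u in E, ‖F N x u‖ ^ 2 := by
  rw [gram_self_eq hE, Complex.ofReal_re]

/-- `Re gram(x,x) ≥ 0`. -/
theorem gram_self_nonneg {a : ℝ} (hE : E ⊆ Icc (-a) a) (x : truncIdx N → ℂ) : 0 ≤ (gram E N x x).re := by
  rw [gram_self_re hE]
  exact integral_nonneg fun u ↦ by positivity

/-- Row `γ̄` of the eigen-equation: for an eigenvector `v` of `𝒦_E(Γ_N)` with eigenvalue `μ` and any `x`,
`⟨x, v⟩_G = μ · Σ_γ x̄_γ v_{γ̄}` (this is `G v = μ P v`). -/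
theorem gram_eigvec {μ : ℂ} {v : truncIdx N → ℂ} (hv : (truncKMat E N).mulVec v = μ • v)
    (x : truncIdx N → ℂ) : gram E N x v = μ * ∑ j, conj (x j) * v (tbar j) := by
  have hrow : ∀ i : truncIdx N,
      ∑ j : truncIdx N, KE E ((i : ZeroIdx).gamma) ((j : ZeroIdx).gamma) * v j = μ * v i := by
    intro i
    have := congrFun hv i
    simpa [Matrix.mulVec, dotProduct, truncKMat, KMat] using this
  calc gram E N x v
      = ∑ j, conj (x j) *
          ∑ l : truncIdx N, KE E (((tbar j : truncIdx N) : ZeroIdx).gamma) ((l : ZeroIdx).gamma) * v l := by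
        rw [gram]
        refine Finset.sum_congr rfl fun j _ ↦ ?_
        rw [Finset.mul_sum]
        exact Finset.sum_congr rfl fun l _ ↦ by rw [gamma_tbar j]; ring
    _ = μ * ∑ j, conj (x j) * v (tbar j) := by
        rw [Finset.mul_sum]
        exact Finset.sum_congr rfl fun j _ ↦ by rw [hrow (tbar j)]; ring

/-- `u ↦ F N x u` is continuous. -/
theorem continuous_F (x : truncIdx N → ℂ) : Continuous fun u : ℝ ↦ F N x u := by
  unfold F
  fun_prop

/-! ## §2 (K1) Off-line Bessel bounds control the whole negative spectrum -/

/-- An OFF-LINE BESSEL (upper Gram) BOUND at level `N` on the window `E` with constant `B`: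
`‖Σ_{γ off-line} x_γ e_γ‖²_{L²(E)} ≤ B Σ|x_γ|²` for every `x` supported on the off-line slots of `Γ_N`. -/
def OffGramBound (E : Set ℝ) (N : ℕ) (B : ℝ) : Prop :=
  ∀ x : truncIdx N → ℂ, (∀ i : truncIdx N, ¬ (i : ZeroIdx).OffLine → x i = 0) →
    ∫ u in E, ‖F N x u‖ ^ 2 ≤ B * ∑ i, ‖x i‖ ^ 2

/-- **(K1) kernel, RH-free, J-free.** For a negative real eigenvalue `μ` of `𝒦_E(Γ_N)` with unit eigenvector `v`
and any off-line Bessel bound `B`: `−B · m_off(v) ≤ μ`, where `m_off(v)` is the off-line `ℓ²`-mass of `v`.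
Proof: with `y_γ = v_{γ̄}` on off-line slots (else `0`), `0 ≤ ‖F_{v+y}‖² = Re[⟨v,v⟩_G + 2⟨y,v⟩_G + ⟨y,y⟩_G]
= μ Re Σ v̄_γ v_{γ̄} + 2 μ m_off + ‖F_y‖² ≤ |μ|(m_off − m_on) − 2|μ| m_off + B m_off = −|μ| + B m_off`.
[new-in-kernel; sharpens Bombieri2000Weil §10 (U2), which bounds `|λ_N|` by `√(2J)·max|K|`] -/
theorem negEig_re_ge_of_offGramBound {a : ℝ} (hE : E ⊆ Icc (-a) a) {μ : ℂ} (him : μ.im = 0)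
    (hre : μ.re < 0) {v : truncIdx N → ℂ} (hv : (truncKMat E N).mulVec v = μ • v)
    (hnorm : ∑ i, ‖v i‖ ^ 2 = 1) {B : ℝ} (hB : OffGramBound E N B) :
    -(B * ∑ i ∈ Finset.univ.filter (fun i : truncIdx N ↦ (i : ZeroIdx).OffLine), ‖v i‖ ^ 2) ≤ μ.re := by
  set P : truncIdx N → Prop := fun i ↦ (i : ZeroIdx).OffLine with hPdef
  set moff : ℝ := ∑ i ∈ Finset.univ.filter P, ‖v i‖ ^ 2 with hmoff
  set mon : ℝ := ∑ i ∈ Finset.univ.filter (fun i ↦ ¬ P i), ‖v i‖ ^ 2 with hmon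
  have hsplit1 : moff + mon = 1 := by
    rw [hmoff, hmon, Finset.sum_filter_add_sum_filter_not, hnorm]
  -- reindexing the off-line slots by `bar`
  have hreidx : ∀ f : truncIdx N → ℝ,
      ∑ j ∈ Finset.univ.filter P, f (tbar j) = ∑ j ∈ Finset.univ.filter P, f j := by
    intro f
    refine Finset.sum_nbij' tbar tbar ?_ ?_ (fun j _ ↦ tbar_tbar j) (fun j _ ↦ tbar_tbar j) (fun j _ ↦ rfl)
    · intro j hj
      have hj' : (j : ZeroIdx).OffLine := (Finset.mem_filter.1 hj).2
      exact Finset.mem_filter.2 ⟨Finset.mem_univ _, (offLine_bar _).2 hj'⟩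
    · intro j hj
      have hj' : (j : ZeroIdx).OffLine := (Finset.mem_filter.1 hj).2
      exact Finset.mem_filter.2 ⟨Finset.mem_univ _, (offLine_bar _).2 hj'⟩
  -- the reflected off-line part of `v`
  set y : truncIdx N → ℂ := fun i ↦ if P i then v (tbar i) else 0 with hy
  have hy_on : ∀ i : truncIdx N, ¬ (i : ZeroIdx).OffLine → y i = 0 := fun i hi ↦ by
    simp [hy, hPdef, hi]
  have hy_off : ∀ i, P i → y i = v (tbar i) := fun i hi ↦ by simp [hy, hi]
  have hynorm : ∑ i, ‖y i‖ ^ 2 = moff := by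
    rw [← Finset.sum_filter_add_sum_filter_not Finset.univ P]
    have h1 : ∑ i ∈ Finset.univ.filter P, ‖y i‖ ^ 2 = ∑ i ∈ Finset.univ.filter P, ‖v (tbar i)‖ ^ 2 :=
      Finset.sum_congr rfl fun i hi ↦ by rw [hy_off i (Finset.mem_filter.1 hi).2]
    have h2 : ∑ i ∈ Finset.univ.filter (fun i ↦ ¬ P i), ‖y i‖ ^ 2 = 0 :=
      Finset.sum_eq_zero fun i hi ↦ by rw [hy_on i (Finset.mem_filter.1 hi).2]; simp
    rw [h1, h2, add_zero, hreidx (fun i ↦ ‖v i‖ ^ 2)]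
  -- the four pairings
  set S : ℂ := ∑ j, conj (v j) * v (tbar j) with hS
  have hvv : gram E N v v = μ * S := gram_eigvec hv v
  have hyv : gram E N y v = μ * moff := by
    rw [gram_eigvec hv y]
    congr 1
    rw [← Finset.sum_filter_add_sum_filter_not Finset.univ P]
    have h1 : ∑ j ∈ Finset.univ.filter P, conj (y j) * v (tbar j) =
        ∑ j ∈ Finset.univ.filter P, (((‖v (tbar j)‖ ^ 2 : ℝ)) : ℂ) :=
      Finset.sum_congr rfl fun j hj ↦ by
        rw [hy_off j (Finset.mem_filter.1 hj).2, RCLike.conj_mul]; norm_cast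
    have h2 : ∑ j ∈ Finset.univ.filter (fun j ↦ ¬ P j), conj (y j) * v (tbar j) = 0 :=
      Finset.sum_eq_zero fun j hj ↦ by rw [hy_on j (Finset.mem_filter.1 hj).2]; simp
    rw [h1, h2, add_zero, hmoff, ← hreidx (fun i ↦ ‖v i‖ ^ 2)]
    push_cast
    rfl
  have hvy : gram E N v y = μ * moff := by
    rw [← conj_gram, hyv, map_mul, Complex.conj_ofReal, Complex.conj_eq_iff_im.2 him]
  have hyy : (gram E N y y).re ≤ B * moff := by
    rw [gram_self_re hE, ← hynorm]
    exact hB y hy_on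
  -- Re S ≥ m_on − m_off (as in Lemma 13)
  have hsplitS : S.re = (∑ j ∈ Finset.univ.filter P, (conj (v j) * v (tbar j)).re) +
      ∑ j ∈ Finset.univ.filter (fun j ↦ ¬ P j), (conj (v j) * v (tbar j)).re := by
    rw [hS, Complex.re_sum, Finset.sum_filter_add_sum_filter_not]
  have hon : ∑ j ∈ Finset.univ.filter (fun j ↦ ¬ P j), (conj (v j) * v (tbar j)).re = mon := by
    refine Finset.sum_congr rfl fun j hj ↦ ?_
    have hj' : ¬ (j : ZeroIdx).OffLine := (Finset.mem_filter.1 hj).2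
    rw [tbar_eq_self hj', mul_comm, Complex.mul_conj, Complex.normSq_eq_norm_sq]
    norm_cast
  have hoff : -moff ≤ ∑ j ∈ Finset.univ.filter P, (conj (v j) * v (tbar j)).re := by
    have hpt : ∀ j, -((‖v j‖ ^ 2 + ‖v (tbar j)‖ ^ 2) / 2) ≤ (conj (v j) * v (tbar j)).re := by
      intro j
      have h1 : |(conj (v j) * v (tbar j)).re| ≤ ‖v j‖ * ‖v (tbar j)‖ := by
        calc |(conj (v j) * v (tbar j)).re| ≤ ‖conj (v j) * v (tbar j)‖ := Complex.abs_re_le_norm _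
          _ = ‖v j‖ * ‖v (tbar j)‖ := by rw [norm_mul, Complex.norm_conj]
      have h2 : 2 * ‖v j‖ * ‖v (tbar j)‖ ≤ ‖v j‖ ^ 2 + ‖v (tbar j)‖ ^ 2 := two_mul_le_add_sq _ _
      have h3 := (abs_le.1 h1).1
      linarith
    calc -moff = ∑ j ∈ Finset.univ.filter P, -((‖v j‖ ^ 2 + ‖v (tbar j)‖ ^ 2) / 2) := by
          rw [Finset.sum_neg_distrib, ← Finset.sum_div, Finset.sum_add_distrib, hreidx (fun i ↦ ‖v i‖ ^ 2)]
          ring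
      _ ≤ ∑ j ∈ Finset.univ.filter P, (conj (v j) * v (tbar j)).re := Finset.sum_le_sum fun j _ ↦ hpt j
  have hSre : mon - moff ≤ S.re := by rw [hsplitS, hon]; linarith
  -- positivity at `v + y`
  have hpos : 0 ≤ (gram E N (v + y) (v + y)).re := gram_self_nonneg hE _
  rw [gram_add_add, hvv, hvy, hyv] at hpos
  simp only [Complex.add_re, Complex.mul_re, him, zero_mul, sub_zero, Complex.ofReal_re,
    Complex.ofReal_im, mul_zero] at hpos
  have h1 : μ.re * S.re ≤ μ.re * (mon - moff) := mul_le_mul_of_nonpos_left hSre hre.le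
  nlinarith

/-- Uniform form: `−B ≤ μ` (as `m_off ≤ 1`, `0 ≤ B`). -/
theorem negEig_re_ge_of_offGramBound' {a : ℝ} (hE : E ⊆ Icc (-a) a) {μ : ℂ} (him : μ.im = 0)
    (hre : μ.re < 0) {v : truncIdx N → ℂ} (hv : (truncKMat E N).mulVec v = μ • v)
    (hnorm : ∑ i, ‖v i‖ ^ 2 = 1) {B : ℝ} (hB0 : 0 ≤ B) (hB : OffGramBound E N B) : -B ≤ μ.re := by
  have h := negEig_re_ge_of_offGramBound hE him hre hv hnorm hB
  have hle : ∑ i ∈ Finset.univ.filter (fun i : truncIdx N ↦ (i : ZeroIdx).OffLine), ‖v i‖ ^ 2 ≤ 1 := by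
    rw [← hnorm]
    exact Finset.sum_le_sum_of_subset_of_nonneg (Finset.filter_subset _ _) fun i _ _ ↦ by positivity
  nlinarith

end Summit.RiemannHypothesis.RiemannHypothesis.Theorems.Splittings.BombieriTruncGram
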